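import Mathlib.NumberTheory.Chebyshev
import Mathlib.Analysis.PSeries
import Mathlib.Analysis.SpecialFunctions.Pow.Complex
import Mathlib.Analysis.SpecialFunctions.Pow.Real
import Mathlib.Algebra.Order.Chebyshev
import HarnessLib

/-!
# Matomäki–Radziwiłł 2016, Lemma 11 (Halász inequality for primes) — elementary tools

Topic `NumberTheory/Sieve`; first file of the reduction of the named fact
`Literature.NumberTheory.Sieve.MatomakiRadziwill2016_lemma11` (`MatomakiRadziwillProp1Inputs.lean`;
K. Matomäki, M. Radziwiłł, *Multiplicative functions in short intervals*, Ann. of Math. 183 (2016),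
Lemma 11) to the Vinogradov–Korobov zero-free region (`Khale2024_zeroFreeRegion`).  Everything here
is PROVED and elementary:

* `MatomakiRadziwillL11.weighted_halasz_montgomery` — the **weighted duality (Halász–Montgomery /
  Selberg) inequality**: for finite sets `S ⊆ S'` of positive integers, weights `w ≥ 0` on `S'`
  with `w > 0` on `S`, and points `𝒯 ⊂ ℝ`, if the weighted kernel
  `K(τ) = ∑_{n ∈ S'} w_n n^{-iτ}` satisfies `∑_{t' ∈ 𝒯} |K(t - t')| ≤ B` for every `t ∈ 𝒯`, then
  `∑_{t ∈ 𝒯} |∑_{n ∈ S} a_n n^{-it}|² ≤ B ∑_{n ∈ S} |a_n|²/w_n`.  This packages the opening lines of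
  the printed proof ("By the duality principle … it is enough to prove that
  `∑_p log p |∑_t η_t p^{it}|² ≪ … ∑_t |η_t|²` … Opening the square … using
  `|η_t η_{t'}| ≤ |η_t|² + |η_{t'}|²`"), in the primal form of Iwaniec–Kowalski, Thm 9.6.
* `MatomakiRadziwillL11.card_le_of_wellSpaced` — a `1`-spaced set in `[-T, T]` has at most `2T + 1`
  points; `MatomakiRadziwillL11.sum_inv_one_add_sq_le` — `∑_{t' ∈ 𝒯} 1/(1 + (t - t')²) ≤ 6` for a
  `1`-spaced `𝒯` (the printed "`∑_{t ∈ 𝒯} |f̃(1 - i(t - t'))| = O(1)`").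
* `MatomakiRadziwillL11.card_primes_Icc_le`, `MatomakiRadziwillL11.trivial_bound` — Chebyshev's
  `θ(x) ≤ x log 4` (Mathlib) gives `#{P ≤ p ≤ 2P} ≤ 2 log 4 · P/log P` and the trivial bound
  `∑_{t ∈ 𝒯} |∑_p a_p p^{-it}|² ≤ #𝒯 · 2 log 4 · P · ∑_p |a_p|²/log P`, which settles Lemma 11 for
  bounded `T` and in the range where its second term dominates.

## References

* K. Matomäki, M. Radziwiłł, Ann. of Math. (2) 183 (2016), 1015–1056, Lemma 10 (duality), Lemma 11
  (arXiv:1501.04585, pp. 11–12).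
* H. Iwaniec, E. Kowalski, *Analytic Number Theory*, AMS Coll. Publ. 53 (2004), Theorem 9.6 and (7.4).
-/

noncomputable section

open Finset Complex
open scoped ComplexConjugate

namespace Literature.NumberTheory.Sieve

namespace MatomakiRadziwillL11

/-! ### Powers `n^{-it}` -/

/-- `conj (n^{s}) = n^{conj s}` for a natural number `n`. [folklore] -/
theorem conj_natCast_cpow (n : ℕ) (s : ℂ) : conj ((n : ℂ) ^ s) = (n : ℂ) ^ (conj s) := by
  have h := Complex.conj_cpow (n : ℂ) (conj s)
    (by rw [Complex.natCast_arg]; exact Real.pi_ne_zero.symm)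
  rw [Complex.conj_conj, Complex.conj_natCast] at h
  exact h.symm

/-- `conj (n^{-it}) = n^{it}`. [folklore] -/
theorem conj_cpow_neg_mul_I (n : ℕ) (t : ℝ) :
    conj ((n : ℂ) ^ (-((t : ℂ) * I))) = (n : ℂ) ^ ((t : ℂ) * I) := by
  rw [conj_natCast_cpow]
  congr 1
  simp [Complex.conj_ofReal]

/-- `‖n^{-it}‖ = 1` for `n ≥ 1`. [folklore] -/
theorem norm_cpow_neg_mul_I {n : ℕ} (hn : n ≠ 0) (t : ℝ) :
    ‖(n : ℂ) ^ (-((t : ℂ) * I))‖ = 1 := by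
  rw [Complex.norm_natCast_cpow_of_pos (Nat.pos_of_ne_zero hn)]
  simp

/-- `n^{-it} · conj(n^{-it'}) = n^{-i(t - t')}` for `n ≥ 1`. [folklore] -/
theorem cpow_mul_conj_cpow {n : ℕ} (hn : n ≠ 0) (t t' : ℝ) :
    (n : ℂ) ^ (-((t : ℂ) * I)) * conj ((n : ℂ) ^ (-((t' : ℂ) * I)))
      = (n : ℂ) ^ (-(((t - t' : ℝ) : ℂ) * I)) := by
  rw [conj_cpow_neg_mul_I, ← Complex.cpow_add _ _ (by exact_mod_cast hn)]
  congr 1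
  push_cast
  ring

/-! ### The weighted kernel and the weighted Halász–Montgomery inequality -/

/-- The weighted kernel `K(τ) = ∑_{n ∈ S'} w_n n^{-iτ}` (the Gram entries of the vectors
`(√w_n n^{-it})_n`). [folklore] -/
def wkernel (S' : Finset ℕ) (w : ℕ → ℝ) (τ : ℝ) : ℂ :=
  ∑ n ∈ S', (w n : ℂ) * (n : ℂ) ^ (-((τ : ℂ) * I))

/-- `K(-τ) = conj K(τ)` (the weights are real). [folklore] -/
theorem wkernel_neg (S' : Finset ℕ) (w : ℕ → ℝ) (τ : ℝ) :
    wkernel S' w (-τ) = conj (wkernel S' w τ) := by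
  unfold wkernel
  rw [map_sum]
  refine Finset.sum_congr rfl fun n _ => ?_
  rw [map_mul, Complex.conj_ofReal, conj_cpow_neg_mul_I]
  congr 1
  push_cast
  ring_nf

/-- `‖K(-τ)‖ = ‖K(τ)‖`. [folklore] -/
theorem norm_wkernel_neg (S' : Finset ℕ) (w : ℕ → ℝ) (τ : ℝ) :
    ‖wkernel S' w (-τ)‖ = ‖wkernel S' w τ‖ := by
  rw [wkernel_neg, Complex.norm_conj]

/-- **Weighted Halász–Montgomery (duality) inequality.**  Let `S ⊆ S'` be finite sets of positive
integers, `w ≥ 0` on `S'` and `w > 0` on `S`, and let `𝒯` be a finite set of reals.  If the weighted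
kernel `K(τ) = ∑_{n ∈ S'} w_n n^{-iτ}` satisfies `∑_{t' ∈ 𝒯} ‖K(t - t')‖ ≤ B` for every `t ∈ 𝒯`, then
`∑_{t ∈ 𝒯} ‖∑_{n ∈ S} a_n n^{-it}‖² ≤ B ∑_{n ∈ S} ‖a_n‖²/w_n`.
Proof: with `c_t = ∑_{n ∈ S} a_n n^{-it}` and `d_n = ∑_t conj(c_t) n^{-it}` one has
`∑_t |c_t|² = ∑_{n ∈ S} a_n d_n ≤ (∑_S |a_n|²/w_n)^{1/2} (∑_S w_n |d_n|²)^{1/2}` and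
`∑_{S} w_n|d_n|² ≤ ∑_{S'} w_n |d_n|² = ∑_{t,t'} conj(c_t) c_{t'} K(t - t') ≤ B ∑_t |c_t|²`
by `|c_t c_{t'}| ≤ (|c_t|² + |c_{t'}|²)/2` and `‖K(t' - t)‖ = ‖K(t - t')‖`.  This is the dual form
in which Matomäki–Radziwiłł prove their Lemma 11 (via Lemma 10).
[cite: IwaniecKowalski2004, Theorem 9.6 (proof; cf. (7.4))] -/
theorem weighted_halasz_montgomery (S S' : Finset ℕ) (hSS' : S ⊆ S') (hS' : ∀ n ∈ S', n ≠ 0)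
    (w : ℕ → ℝ) (hw0 : ∀ n ∈ S', 0 ≤ w n) (hw : ∀ n ∈ S, 0 < w n) (a : ℕ → ℂ) (𝒯 : Finset ℝ)
    {B : ℝ} (hB0 : 0 ≤ B) (hB : ∀ t ∈ 𝒯, ∑ t' ∈ 𝒯, ‖wkernel S' w (t - t')‖ ≤ B) :
    ∑ t ∈ 𝒯, ‖∑ n ∈ S, a n * (n : ℂ) ^ (-((t : ℂ) * I))‖ ^ 2 ≤
      B * ∑ n ∈ S, ‖a n‖ ^ 2 / w n := by
  classical
  set c : ℝ → ℂ := fun t => ∑ n ∈ S, a n * (n : ℂ) ^ (-((t : ℂ) * I)) with hc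
  set S0 : ℝ := ∑ t ∈ 𝒯, ‖c t‖ ^ 2 with hS0
  set d : ℕ → ℂ := fun n => ∑ t ∈ 𝒯, conj (c t) * (n : ℂ) ^ (-((t : ℂ) * I)) with hd
  set Aw : ℝ := ∑ n ∈ S, ‖a n‖ ^ 2 / w n with hAw
  have hS0nn : 0 ≤ S0 := Finset.sum_nonneg fun _ _ => sq_nonneg _
  have hAwnn : 0 ≤ Aw := Finset.sum_nonneg fun n hn => div_nonneg (sq_nonneg _) (hw n hn).le
  -- Step 1: `S0 = ∑_{n ∈ S} a_n d_n`
  have step1 : (S0 : ℂ) = ∑ n ∈ S, a n * d n := by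
    have e1 : (S0 : ℂ) = ∑ t ∈ 𝒯, conj (c t) * c t := by
      rw [hS0]; push_cast
      refine Finset.sum_congr rfl fun t _ => ?_
      rw [Complex.conj_mul']
    rw [e1]
    simp only [hd, Finset.mul_sum]
    rw [Finset.sum_comm]
    refine Finset.sum_congr rfl fun t _ => ?_
    simp only [hc, Finset.mul_sum]
    refine Finset.sum_congr rfl fun n _ => ?_
    ring
  -- Step 2: weighted Cauchy–Schwarz `S0² ≤ Aw · Dw`, `Dw = ∑_{n ∈ S} w_n |d_n|²`
  set Dw : ℝ := ∑ n ∈ S, w n * ‖d n‖ ^ 2 with hDw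
  have step2 : S0 ^ 2 ≤ Aw * Dw := by
    have h1 : S0 ≤ ∑ n ∈ S, ‖a n‖ / Real.sqrt (w n) * (Real.sqrt (w n) * ‖d n‖) := by
      have : S0 = ‖(S0 : ℂ)‖ := by
        rw [Complex.norm_real, Real.norm_eq_abs, abs_of_nonneg hS0nn]
      rw [this, step1]
      refine (norm_sum_le _ _).trans (Finset.sum_le_sum fun n hn => ?_)
      have hs : 0 < Real.sqrt (w n) := Real.sqrt_pos.2 (hw n hn)
      have heq : ‖a n‖ / Real.sqrt (w n) * (Real.sqrt (w n) * ‖d n‖) = ‖a n‖ * ‖d n‖ := by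
        field_simp
      rw [heq, norm_mul]
    have h2 := Finset.sum_mul_sq_le_sq_mul_sq S (fun n => ‖a n‖ / Real.sqrt (w n))
      (fun n => Real.sqrt (w n) * ‖d n‖)
    have h3 : ∑ n ∈ S, (‖a n‖ / Real.sqrt (w n)) ^ 2 = Aw := by
      rw [hAw]
      refine Finset.sum_congr rfl fun n hn => ?_
      rw [div_pow, Real.sq_sqrt (hw n hn).le]
    have h4 : ∑ n ∈ S, (Real.sqrt (w n) * ‖d n‖) ^ 2 = Dw := by
      rw [hDw]
      refine Finset.sum_congr rfl fun n hn => ?_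
      rw [mul_pow, Real.sq_sqrt (hw n hn).le]
    have h0 : 0 ≤ ∑ n ∈ S, ‖a n‖ / Real.sqrt (w n) * (Real.sqrt (w n) * ‖d n‖) :=
      hS0nn.trans h1
    calc S0 ^ 2 ≤ (∑ n ∈ S, ‖a n‖ / Real.sqrt (w n) * (Real.sqrt (w n) * ‖d n‖)) ^ 2 :=
          pow_le_pow_left₀ hS0nn h1 2
      _ ≤ Aw * Dw := by rw [← h3, ← h4]; exact h2
  -- Step 3: `Dw ≤ Dw' = ∑_{n ∈ S'} w_n |d_n|² = ∑_{t,t'} conj(c_t) c_{t'} K(t - t') ≤ B · S0`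
  set Dw' : ℝ := ∑ n ∈ S', w n * ‖d n‖ ^ 2 with hDw'
  have hDD : Dw ≤ Dw' :=
    Finset.sum_le_sum_of_subset_of_nonneg hSS' fun n hn _ => mul_nonneg (hw0 n hn) (sq_nonneg _)
  have hDw'nn : 0 ≤ Dw' := Finset.sum_nonneg fun n hn => mul_nonneg (hw0 n hn) (sq_nonneg _)
  have step3 : Dw' ≤ B * S0 := by
    have e1 : (Dw' : ℂ) = ∑ t ∈ 𝒯, ∑ t' ∈ 𝒯, conj (c t) * c t' * wkernel S' w (t - t') := by
      rw [hDw']; push_cast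
      have e2 : ∀ n ∈ S', (w n : ℂ) * ((‖d n‖ : ℂ)) ^ 2
          = ∑ t ∈ 𝒯, ∑ t' ∈ 𝒯, conj (c t) * c t' *
              ((w n : ℂ) * ((n : ℂ) ^ (-((t : ℂ) * I)) * conj ((n : ℂ) ^ (-((t' : ℂ) * I))))) := by
        intro n _
        rw [← Complex.mul_conj' (d n)]
        simp only [hd]
        rw [map_sum, Finset.sum_mul_sum, Finset.mul_sum]
        refine Finset.sum_congr rfl fun t _ => ?_
        rw [Finset.mul_sum]
        refine Finset.sum_congr rfl fun t' _ => ?_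
        rw [map_mul, Complex.conj_conj]
        ring
      rw [Finset.sum_congr rfl e2, Finset.sum_comm]
      refine Finset.sum_congr rfl fun t _ => ?_
      rw [Finset.sum_comm]
      refine Finset.sum_congr rfl fun t' _ => ?_
      conv_rhs => rw [wkernel, Finset.mul_sum]
      refine Finset.sum_congr rfl fun n hn => ?_
      rw [← cpow_mul_conj_cpow (hS' n hn)]
    have h1 : Dw' ≤ ∑ t ∈ 𝒯, ∑ t' ∈ 𝒯, ‖c t‖ * ‖c t'‖ * ‖wkernel S' w (t - t')‖ := by
      have : Dw' = ‖(Dw' : ℂ)‖ := by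
        rw [Complex.norm_real, Real.norm_eq_abs, abs_of_nonneg hDw'nn]
      rw [this, e1]
      refine (norm_sum_le _ _).trans (Finset.sum_le_sum fun t _ => ?_)
      refine (norm_sum_le _ _).trans (Finset.sum_le_sum fun t' _ => ?_)
      rw [norm_mul, norm_mul, Complex.norm_conj]
    have h2 : ∀ t ∈ 𝒯, ∀ t' ∈ 𝒯, ‖c t‖ * ‖c t'‖ * ‖wkernel S' w (t - t')‖
        ≤ (‖c t‖ ^ 2 / 2) * ‖wkernel S' w (t - t')‖
          + (‖c t'‖ ^ 2 / 2) * ‖wkernel S' w (t' - t)‖ := by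
      intro t _ t' _
      rw [show t' - t = -(t - t') by ring, norm_wkernel_neg]
      have := two_mul_le_add_sq ‖c t‖ ‖c t'‖
      nlinarith [norm_nonneg (wkernel S' w (t - t')), norm_nonneg (c t), norm_nonneg (c t')]
    have h3 : ∑ t ∈ 𝒯, ∑ t' ∈ 𝒯, ‖c t‖ * ‖c t'‖ * ‖wkernel S' w (t - t')‖
        ≤ ∑ t ∈ 𝒯, ∑ t' ∈ 𝒯, ((‖c t‖ ^ 2 / 2) * ‖wkernel S' w (t - t')‖
          + (‖c t'‖ ^ 2 / 2) * ‖wkernel S' w (t' - t)‖) :=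
      Finset.sum_le_sum fun t ht => Finset.sum_le_sum fun t' ht' => h2 t ht t' ht'
    have h4 : ∑ t ∈ 𝒯, ∑ t' ∈ 𝒯, ((‖c t‖ ^ 2 / 2) * ‖wkernel S' w (t - t')‖
          + (‖c t'‖ ^ 2 / 2) * ‖wkernel S' w (t' - t)‖)
        = ∑ t ∈ 𝒯, (‖c t‖ ^ 2 / 2) * ∑ t' ∈ 𝒯, ‖wkernel S' w (t - t')‖
          + ∑ t' ∈ 𝒯, (‖c t'‖ ^ 2 / 2) * ∑ t ∈ 𝒯, ‖wkernel S' w (t' - t)‖ := by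
      have ea : ∀ t ∈ 𝒯, ∑ t' ∈ 𝒯, ((‖c t‖ ^ 2 / 2) * ‖wkernel S' w (t - t')‖
            + (‖c t'‖ ^ 2 / 2) * ‖wkernel S' w (t' - t)‖)
          = (‖c t‖ ^ 2 / 2) * ∑ t' ∈ 𝒯, ‖wkernel S' w (t - t')‖
            + ∑ t' ∈ 𝒯, (‖c t'‖ ^ 2 / 2) * ‖wkernel S' w (t' - t)‖ := by
        intro t _
        rw [Finset.sum_add_distrib, Finset.mul_sum]
      rw [Finset.sum_congr rfl ea, Finset.sum_add_distrib]
      congr 1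
      rw [Finset.sum_comm]
      refine Finset.sum_congr rfl fun t' _ => ?_
      rw [Finset.mul_sum]
    have h5 : ∑ t ∈ 𝒯, (‖c t‖ ^ 2 / 2) * ∑ t' ∈ 𝒯, ‖wkernel S' w (t - t')‖
        ≤ ∑ t ∈ 𝒯, (‖c t‖ ^ 2 / 2) * B :=
      Finset.sum_le_sum fun t ht => mul_le_mul_of_nonneg_left (hB t ht) (by positivity)
    have h5' : ∑ t' ∈ 𝒯, (‖c t'‖ ^ 2 / 2) * ∑ t ∈ 𝒯, ‖wkernel S' w (t' - t)‖
        ≤ ∑ t' ∈ 𝒯, (‖c t'‖ ^ 2 / 2) * B :=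
      Finset.sum_le_sum fun t ht => mul_le_mul_of_nonneg_left (hB t ht) (by positivity)
    have h6 : ∑ t ∈ 𝒯, (‖c t‖ ^ 2 / 2) * B = B * S0 / 2 := by
      rw [hS0, ← Finset.sum_mul, ← Finset.sum_div]; ring
    calc Dw' ≤ _ := h1
      _ ≤ _ := h3
      _ = _ := h4
      _ ≤ ∑ t ∈ 𝒯, (‖c t‖ ^ 2 / 2) * B + ∑ t' ∈ 𝒯, (‖c t'‖ ^ 2 / 2) * B := add_le_add h5 h5'
      _ = B * S0 := by rw [h6]; ring
  -- Step 4: conclude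
  have hfin : S0 ^ 2 ≤ Aw * (B * S0) :=
    step2.trans (mul_le_mul_of_nonneg_left (hDD.trans step3) hAwnn)
  change S0 ≤ B * Aw
  rcases eq_or_lt_of_le hS0nn with h0 | hpos
  · rw [← h0]; positivity
  · have : S0 * S0 ≤ (B * Aw) * S0 := by nlinarith
    exact le_of_mul_le_mul_right this hpos

/-! ### Well-spaced sets of points -/

/-- A set of points of `[-T, T]` which are pairwise at distance `≥ 1` has at most `2T + 1` elements
(the integer parts of `t + T`, `t ∈ 𝒯`, are distinct elements of `{0, …, ⌊2T⌋}`). [folklore] -/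
theorem card_le_of_wellSpaced {𝒯 : Finset ℝ} {T : ℝ} (hT : 0 ≤ T) (h𝒯 : ∀ t ∈ 𝒯, |t| ≤ T)
    (hsep : ∀ t ∈ 𝒯, ∀ t' ∈ 𝒯, t ≠ t' → 1 ≤ |t - t'|) : (#𝒯 : ℝ) ≤ 2 * T + 1 := by
  classical
  set f : ℝ → ℕ := fun t => ⌊t + T⌋₊ with hf
  have hinj : Set.InjOn f 𝒯 := by
    intro t ht t' ht' hft
    by_contra hne
    have h1 := hsep t ht t' ht' hne
    have ht0 : 0 ≤ t + T := by have := (abs_le.1 (h𝒯 t ht)).1; linarith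
    have ht'0 : 0 ≤ t' + T := by have := (abs_le.1 (h𝒯 t' ht')).1; linarith
    have a1 : ((⌊t + T⌋₊ : ℕ) : ℝ) ≤ t + T := Nat.floor_le ht0
    have a2 : t + T < ((⌊t + T⌋₊ : ℕ) : ℝ) + 1 := Nat.lt_floor_add_one (t + T)
    have b1 : ((⌊t' + T⌋₊ : ℕ) : ℝ) ≤ t' + T := Nat.floor_le ht'0
    have b2 : t' + T < ((⌊t' + T⌋₊ : ℕ) : ℝ) + 1 := Nat.lt_floor_add_one (t' + T)
    have hft' : (⌊t + T⌋₊ : ℕ) = ⌊t' + T⌋₊ := hft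
    rw [hft'] at a1 a2
    have : |t - t'| < 1 := by
      rw [abs_lt]; constructor <;> linarith
    linarith
  have himg : 𝒯.image f ⊆ Finset.range (⌊2 * T⌋₊ + 1) := by
    intro k hk
    rw [Finset.mem_image] at hk
    obtain ⟨t, ht, rfl⟩ := hk
    rw [Finset.mem_range, Nat.lt_add_one_iff]
    apply Nat.floor_le_floor
    have := (abs_le.1 (h𝒯 t ht)).2
    linarith
  have hcard : #𝒯 ≤ ⌊2 * T⌋₊ + 1 := by
    calc #𝒯 = #(𝒯.image f) := (Finset.card_image_of_injOn hinj).symm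
      _ ≤ #(Finset.range (⌊2 * T⌋₊ + 1)) := Finset.card_le_card himg
      _ = ⌊2 * T⌋₊ + 1 := Finset.card_range _
  calc (#𝒯 : ℝ) ≤ ((⌊2 * T⌋₊ + 1 : ℕ) : ℝ) := by exact_mod_cast hcard
    _ = ((⌊2 * T⌋₊ : ℕ) : ℝ) + 1 := by push_cast; ring
    _ ≤ 2 * T + 1 := by linarith [Nat.floor_le (show 0 ≤ 2 * T by linarith)]

/-- `∑_{j = 0}^{M} 1/(1 + j²) ≤ 3` (`1 + ∑_{j ≥ 1} 1/j² ≤ 1 + 2`). [folklore] -/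
theorem sum_range_inv_one_add_sq_le (M : ℕ) :
    ∑ j ∈ Finset.range (M + 1), 1 / (1 + (j : ℝ) ^ 2) ≤ 3 := by
  rw [Finset.range_eq_Ico, ← Finset.Ioo_insert_left (Nat.succ_pos M),
    Finset.sum_insert (by simp)]
  have h1 : ∑ j ∈ Finset.Ioo 0 (M + 1), 1 / (1 + (j : ℝ) ^ 2) ≤
      ∑ j ∈ Finset.Ioo 0 (M + 1), ((j : ℝ) ^ 2)⁻¹ := by
    refine Finset.sum_le_sum fun j hj => ?_
    have hj1 : (1 : ℝ) ≤ j := by exact_mod_cast (Finset.mem_Ioo.1 hj).1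
    rw [one_div]
    exact inv_anti₀ (by positivity) (by linarith)
  have h2 := sum_Ioo_inv_sq_le (α := ℝ) 0 (M + 1)
  simp only [Nat.cast_zero, zero_add, div_one] at h2
  have h3 : (1 : ℝ) / (1 + ((0 : ℕ) : ℝ) ^ 2) = 1 := by norm_num
  rw [h3]
  linarith

/-- For a finite set `U` of nonnegative reals pairwise at distance `≥ 1`,
`∑_{x ∈ U} 1/(1 + x²) ≤ 3` (the integer parts are distinct, and `1/(1 + x²) ≤ 1/(1 + ⌊x⌋²)`).
[folklore] -/
theorem sum_inv_one_add_sq_le_three {U : Finset ℝ} (hU : ∀ x ∈ U, 0 ≤ x)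
    (hsep : ∀ x ∈ U, ∀ y ∈ U, x ≠ y → 1 ≤ |x - y|) :
    ∑ x ∈ U, 1 / (1 + x ^ 2) ≤ 3 := by
  classical
  set g : ℝ → ℕ := fun x => ⌊x⌋₊ with hg
  have hinj : Set.InjOn g U := by
    intro x hx y hy hgxy
    by_contra hne
    have h1 := hsep x hx y hy hne
    have a1 : ((⌊x⌋₊ : ℕ) : ℝ) ≤ x := Nat.floor_le (hU x hx)
    have a2 : x < ((⌊x⌋₊ : ℕ) : ℝ) + 1 := Nat.lt_floor_add_one x
    have b1 : ((⌊y⌋₊ : ℕ) : ℝ) ≤ y := Nat.floor_le (hU y hy)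
    have b2 : y < ((⌊y⌋₊ : ℕ) : ℝ) + 1 := Nat.lt_floor_add_one y
    have hg' : (⌊x⌋₊ : ℕ) = ⌊y⌋₊ := hgxy
    rw [hg'] at a1 a2
    have : |x - y| < 1 := by
      rw [abs_lt]; constructor <;> linarith
    linarith
  -- termwise comparison with `1/(1 + ⌊x⌋²)`
  have hle : ∀ x ∈ U, 1 / (1 + x ^ 2) ≤ 1 / (1 + ((g x : ℕ) : ℝ) ^ 2) := by
    intro x hx
    have h0 : 0 ≤ ((⌊x⌋₊ : ℕ) : ℝ) := by positivity
    have h1 : ((⌊x⌋₊ : ℕ) : ℝ) ≤ x := Nat.floor_le (hU x hx)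
    have h2 : ((⌊x⌋₊ : ℕ) : ℝ) ^ 2 ≤ x ^ 2 := pow_le_pow_left₀ h0 h1 2
    exact one_div_le_one_div_of_le (by positivity) (by simpa [hg] using h2)
  set M : ℕ := U.sup g with hM
  have himg : U.image g ⊆ Finset.range (M + 1) := by
    intro j hj
    rw [Finset.mem_image] at hj
    obtain ⟨x, hx, rfl⟩ := hj
    rw [Finset.mem_range, Nat.lt_add_one_iff]
    exact Finset.le_sup hx
  calc ∑ x ∈ U, 1 / (1 + x ^ 2) ≤ ∑ x ∈ U, 1 / (1 + ((g x : ℕ) : ℝ) ^ 2) :=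
        Finset.sum_le_sum hle
    _ = ∑ j ∈ U.image g, 1 / (1 + (j : ℝ) ^ 2) := by rw [Finset.sum_image hinj]
    _ ≤ ∑ j ∈ Finset.range (M + 1), 1 / (1 + (j : ℝ) ^ 2) :=
        Finset.sum_le_sum_of_subset_of_nonneg himg fun j _ _ => by positivity
    _ ≤ 3 := sum_range_inv_one_add_sq_le M

/-- **The off-diagonal decay is summable over well-spaced points**: if the points of `𝒯` are
pairwise at distance `≥ 1`, then `∑_{t' ∈ 𝒯} 1/(1 + (t - t')²) ≤ 6` for every real `t` (split
according to `t' ≥ t` or `t' < t` and apply `sum_inv_one_add_sq_le_three` to the distances). [folklore] -/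
theorem sum_inv_one_add_sq_le {𝒯 : Finset ℝ}
    (hsep : ∀ t ∈ 𝒯, ∀ t' ∈ 𝒯, t ≠ t' → 1 ≤ |t - t'|) (t : ℝ) :
    ∑ t' ∈ 𝒯, 1 / (1 + (t - t') ^ 2) ≤ 6 := by
  classical
  rw [← Finset.sum_filter_add_sum_filter_not 𝒯 (fun t' => t ≤ t')]
  -- the points above `t`
  have hup : ∑ t' ∈ 𝒯.filter (fun t' => t ≤ t'), 1 / (1 + (t - t') ^ 2) ≤ 3 := by
    set U := (𝒯.filter (fun t' => t ≤ t')).image (fun t' => t' - t) with hUdef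
    have hinj : Set.InjOn (fun t' : ℝ => t' - t) (𝒯.filter (fun t' => t ≤ t')) :=
      fun x _ y _ h => by simpa using h
    have hsum : ∑ x ∈ U, 1 / (1 + x ^ 2) =
        ∑ t' ∈ 𝒯.filter (fun t' => t ≤ t'), 1 / (1 + (t - t') ^ 2) := by
      rw [hUdef, Finset.sum_image hinj]
      refine Finset.sum_congr rfl fun t' _ => ?_
      ring_nf
    rw [← hsum]
    refine sum_inv_one_add_sq_le_three (fun x hx => ?_) (fun x hx y hy hxy => ?_)
    · rw [hUdef, Finset.mem_image] at hx
      obtain ⟨t', ht', rfl⟩ := hx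
      have := (Finset.mem_filter.1 ht').2
      linarith
    · rw [hUdef, Finset.mem_image] at hx hy
      obtain ⟨a, ha, rfl⟩ := hx
      obtain ⟨b, hb, rfl⟩ := hy
      have hab : a ≠ b := fun h => hxy (by rw [h])
      have := hsep a (Finset.mem_filter.1 ha).1 b (Finset.mem_filter.1 hb).1 hab
      rwa [show a - t - (b - t) = a - b by ring]
  -- the points below `t`
  have hlo : ∑ t' ∈ 𝒯.filter (fun t' => ¬ t ≤ t'), 1 / (1 + (t - t') ^ 2) ≤ 3 := by
    set U := (𝒯.filter (fun t' => ¬ t ≤ t')).image (fun t' => t - t') with hUdef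
    have hinj : Set.InjOn (fun t' : ℝ => t - t') (𝒯.filter (fun t' => ¬ t ≤ t')) :=
      fun x _ y _ h => by simpa using h
    have hsum : ∑ x ∈ U, 1 / (1 + x ^ 2) =
        ∑ t' ∈ 𝒯.filter (fun t' => ¬ t ≤ t'), 1 / (1 + (t - t') ^ 2) := by
      rw [hUdef, Finset.sum_image hinj]
    rw [← hsum]
    refine sum_inv_one_add_sq_le_three (fun x hx => ?_) (fun x hx y hy hxy => ?_)
    · rw [hUdef, Finset.mem_image] at hx
      obtain ⟨t', ht', rfl⟩ := hx
      have := (Finset.mem_filter.1 ht').2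
      push Not at this
      linarith
    · rw [hUdef, Finset.mem_image] at hx hy
      obtain ⟨a, ha, rfl⟩ := hx
      obtain ⟨b, hb, rfl⟩ := hy
      have hab : a ≠ b := fun h => hxy (by rw [h])
      have := hsep a (Finset.mem_filter.1 ha).1 b (Finset.mem_filter.1 hb).1 hab
      rw [show t - a - (t - b) = -(a - b) by ring, abs_neg]
      exact this
  linarith

/-! ### Chebyshev's bound and the trivial estimate -/

/-- **Chebyshev**: the number of primes in `[P, 2P]` is at most `2 log 4 · P/log P` for `P > 1`
(`#{P ≤ p ≤ 2P} · log P ≤ ∑_{P ≤ p ≤ 2P} log p ≤ θ(2P) ≤ 2P log 4`, Mathlib's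
`Chebyshev.theta_le_log4_mul_x`). [folklore] -/
theorem card_primes_Icc_le {P : ℝ} (hP : 1 < P) :
    (#((Icc ⌈P⌉₊ ⌊2 * P⌋₊).filter Nat.Prime) : ℝ) ≤ 2 * Real.log 4 * P / Real.log P := by
  set Pr := (Icc ⌈P⌉₊ ⌊2 * P⌋₊).filter Nat.Prime with hPr
  have hlogP : 0 < Real.log P := Real.log_pos hP
  have h1 : ∑ p ∈ Pr, Real.log p ≤ Chebyshev.theta (2 * P) := by
    rw [Chebyshev.theta]
    apply Finset.sum_le_sum_of_subset_of_nonneg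
    · intro p hp
      rw [hPr, Finset.mem_filter, Finset.mem_Icc] at hp
      rw [Finset.mem_filter, Finset.mem_Ioc]
      exact ⟨⟨hp.2.pos, hp.1.2⟩, hp.2⟩
    · intro p hp _
      exact Real.log_nonneg (by exact_mod_cast (Finset.mem_filter.1 hp).2.one_le)
  have h2 : Chebyshev.theta (2 * P) ≤ Real.log 4 * (2 * P) :=
    Chebyshev.theta_le_log4_mul_x (by linarith)
  have h3 : (#Pr : ℝ) * Real.log P ≤ ∑ p ∈ Pr, Real.log p := by
    rw [Finset.card_eq_sum_ones, Nat.cast_sum, Finset.sum_mul]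
    refine Finset.sum_le_sum fun p hp => ?_
    simp only [Nat.cast_one, one_mul]
    have hp' := Finset.mem_filter.1 hp
    have hPp : P ≤ p := le_trans (Nat.le_ceil P) (by exact_mod_cast (Finset.mem_Icc.1 hp'.1).1)
    exact Real.log_le_log (by linarith) hPp
  rw [le_div_iff₀ hlogP]
  linarith

/-- **The trivial bound**: for `P > 1`, any coefficients and any finite `𝒯 ⊂ ℝ`,
`∑_{t ∈ 𝒯} ‖∑_{P ≤ p ≤ 2P} a_p p^{-it}‖² ≤ #𝒯 · (2 log 4 · P) · ∑_p ‖a_p‖²/log P`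
(Cauchy–Schwarz and `card_primes_Icc_le`). [folklore] -/
theorem trivial_bound {P : ℝ} (hP : 1 < P) (a : ℕ → ℂ) (𝒯 : Finset ℝ) :
    ∑ t ∈ 𝒯, ‖∑ p ∈ (Icc ⌈P⌉₊ ⌊2 * P⌋₊).filter Nat.Prime,
        a p * (p : ℂ) ^ (-((t : ℂ) * I))‖ ^ 2 ≤
      (#𝒯 : ℝ) * (2 * Real.log 4 * P) *
        ∑ p ∈ (Icc ⌈P⌉₊ ⌊2 * P⌋₊).filter Nat.Prime, ‖a p‖ ^ 2 / Real.log P := by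
  set Pr := (Icc ⌈P⌉₊ ⌊2 * P⌋₊).filter Nat.Prime with hPr
  have hlogP : 0 < Real.log P := Real.log_pos hP
  have hP0 : 0 < P := by linarith
  set A : ℝ := ∑ p ∈ Pr, ‖a p‖ ^ 2 with hA
  have hAnn : 0 ≤ A := Finset.sum_nonneg fun _ _ => sq_nonneg _
  have hcard := card_primes_Icc_le hP
  rw [← hPr] at hcard
  -- each term is at most `#Pr · A ≤ (2 log 4 · P / log P) · A`
  have hterm : ∀ t : ℝ, ‖∑ p ∈ Pr, a p * (p : ℂ) ^ (-((t : ℂ) * I))‖ ^ 2 ≤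
      2 * Real.log 4 * P / Real.log P * A := by
    intro t
    have h1 : ‖∑ p ∈ Pr, a p * (p : ℂ) ^ (-((t : ℂ) * I))‖ ≤ ∑ p ∈ Pr, ‖a p‖ := by
      refine (norm_sum_le _ _).trans (Finset.sum_le_sum fun p hp => ?_)
      have hp0 : p ≠ 0 := (Finset.mem_filter.1 hp).2.ne_zero
      rw [norm_mul, norm_cpow_neg_mul_I hp0, mul_one]
    have h2 : (∑ p ∈ Pr, ‖a p‖) ^ 2 ≤ #Pr * A := by
      rw [hA]; exact sq_sum_le_card_mul_sum_sq
    calc ‖∑ p ∈ Pr, a p * (p : ℂ) ^ (-((t : ℂ) * I))‖ ^ 2 ≤ (∑ p ∈ Pr, ‖a p‖) ^ 2 :=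
          pow_le_pow_left₀ (norm_nonneg _) h1 2
      _ ≤ #Pr * A := h2
      _ ≤ 2 * Real.log 4 * P / Real.log P * A := mul_le_mul_of_nonneg_right hcard hAnn
  have hdiv : ∑ p ∈ Pr, ‖a p‖ ^ 2 / Real.log P = A / Real.log P := by
    rw [hA, Finset.sum_div]
  rw [hdiv]
  calc ∑ t ∈ 𝒯, ‖∑ p ∈ Pr, a p * (p : ℂ) ^ (-((t : ℂ) * I))‖ ^ 2
      ≤ ∑ _t ∈ 𝒯, 2 * Real.log 4 * P / Real.log P * A := Finset.sum_le_sum fun t _ => hterm t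
    _ = (#𝒯 : ℝ) * (2 * Real.log 4 * P / Real.log P * A) := by
        rw [Finset.sum_const, nsmul_eq_mul]
    _ = (#𝒯 : ℝ) * (2 * Real.log 4 * P) * (A / Real.log P) := by ring

end MatomakiRadziwillL11

end Literature.NumberTheory.Sieve
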